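import Mathlib.Analysis.MellinTransform
import HarnessLib

/-!
# Iterated differentiation under the Mellin integral

LINE 1 — FRAMING: RH-FREE analysis infrastructure (generic Mellin-transform calculus).  Filed from cell
rh-crit, corpus C2/dbl, as the support brick for row «dbl:W2-Ke92» fact `Keiper1992_eq5` (holder
dbl-t12 g2): Keiper's `β_j` (7) are the Taylor coefficients of Riemann's integral (3), i.e. iterated
`s`-derivatives of a Mellin transform taken under the integral sign.  bears_on: L-C/L-P (COLUMN 4, Li).
WHAT THIS IS NOT: calculus; nothing here bears on the truth of the Riemann Hypothesis.

Mathlib has the one-step statement `mellin_hasDerivAt_of_isBigO_rpow` (derivative of `𝓜f` = `𝓜(log·f)`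
inside the strip of absolute convergence).  For a kernel with two-sided decay of every order (the theta
tail `Σ e^{−πn²x}` on `(1, ∞)`, Mathlib's `f_modif` of a strong FE-pair — tree
`RealZeros.kernel_isBigO_atTop`, `RealZeros.kernel_isBigO_nhds_zero`) the strip is all of `ℂ` and the
statement iterates: `(𝓜f)^{(n)}(s) = 𝓜(logⁿ·f)(s)` for every `n` and `s`
([Titchmarsh1986, §2.6 with (2.6.2)]: «the last integral … is an integral function of s»; the printed
use is Riemann's (3) ⇒ Keiper's (7) [Keiper1992, eqs. (3), (7) p.765–766]).

## References
* E. C. Titchmarsh, *The Theory of the Riemann Zeta-Function*, 2nd ed. (1986), §2.6. [Titchmarsh1986]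
* J. B. Keiper, *Power series expansions of Riemann's ξ function*, Math. Comp. 58 (1992) 765–773. [Keiper1992]
-/

noncomputable section

open Filter Topology Real Set MeasureTheory Asymptotics

namespace Literature.Analysis.SpecialFunctions

namespace MellinIteratedDeriv

variable {f : ℝ → ℂ}

/-- Two-sided all-order decay passes to `log t • f t` at `+∞`. [cite: Titchmarsh1986, §2.6] -/
theorem isBigO_log_smul_atTop (htop : ∀ r : ℝ, f =O[atTop] (· ^ r)) (r : ℝ) :
    (fun t : ℝ ↦ Real.log t • f t) =O[atTop] (· ^ r) := by
  have h := isBigO_rpow_top_log_smul (E := ℂ) (a := -r + 1) (b := -r) (by linarith)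
    ((htop (r - 1)).congr_right fun t ↦ by rw [show -(-r + 1) = r - 1 by ring])
  simpa using h

/-- Two-sided all-order decay passes to `log t • f t` at `0⁺`. [cite: Titchmarsh1986, §2.6] -/
theorem isBigO_log_smul_nhds_zero (hbot : ∀ r : ℝ, f =O[𝓝[>] 0] (· ^ r)) (r : ℝ) :
    (fun t : ℝ ↦ Real.log t • f t) =O[𝓝[>] 0] (· ^ r) := by
  have h := isBigO_rpow_zero_log_smul (E := ℂ) (a := -r - 1) (b := -r) (by linarith)
    ((hbot (r + 1)).congr_right fun t ↦ by rw [show -(-r - 1) = r + 1 by ring])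
  simpa using h

/-- All-order decay of `logⁿ t • f t` at `+∞`. [cite: Titchmarsh1986, §2.6] -/
theorem isBigO_log_pow_smul_atTop (htop : ∀ r : ℝ, f =O[atTop] (· ^ r)) (n : ℕ) (r : ℝ) :
    (fun t : ℝ ↦ ((Real.log t) ^ n : ℝ) • f t) =O[atTop] (· ^ r) := by
  induction n generalizing r with
  | zero => simpa using htop r
  | succ n ih =>
    have h := isBigO_log_smul_atTop ih r
    refine h.congr_left fun t ↦ ?_
    simp only [smul_smul, pow_succ, mul_comm]

/-- All-order decay of `logⁿ t • f t` at `0⁺`. [cite: Titchmarsh1986, §2.6] -/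
theorem isBigO_log_pow_smul_nhds_zero (hbot : ∀ r : ℝ, f =O[𝓝[>] 0] (· ^ r)) (n : ℕ) (r : ℝ) :
    (fun t : ℝ ↦ ((Real.log t) ^ n : ℝ) • f t) =O[𝓝[>] 0] (· ^ r) := by
  induction n generalizing r with
  | zero => simpa using hbot r
  | succ n ih =>
    have h := isBigO_log_smul_nhds_zero ih r
    refine h.congr_left fun t ↦ ?_
    simp only [smul_smul, pow_succ, mul_comm]

/-- `logⁿ t • f t` is locally integrable on `(0, ∞)` when `f` is (the integrand of the differentiated
Mellin integral). [cite: Titchmarsh1986, §2.6] -/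
theorem locallyIntegrableOn_log_pow_smul (hfc : LocallyIntegrableOn f (Ioi 0)) (n : ℕ) :
    LocallyIntegrableOn (fun t : ℝ ↦ ((Real.log t) ^ n : ℝ) • f t) (Ioi 0) := by
  refine hfc.continuousOn_smul isOpen_Ioi.isLocallyClosed ?_
  exact (continuousOn_log.mono fun t (ht : 0 < t) ↦ ht.ne').pow n

end MellinIteratedDeriv

open MellinIteratedDeriv in
/-- **One step, everywhere**: under two-sided all-order decay, `𝓜f` has derivative `𝓜(log·f)` at every
`s` (Mathlib `mellin_hasDerivAt_of_isBigO_rpow` with the strip opened around `Re s`).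
[cite: Titchmarsh1986, §2.6] -/
theorem hasDerivAt_mellin_of_isBigO_rpow {f : ℝ → ℂ} (hfc : LocallyIntegrableOn f (Ioi 0))
    (htop : ∀ r : ℝ, f =O[atTop] (· ^ r)) (hbot : ∀ r : ℝ, f =O[𝓝[>] 0] (· ^ r)) (s : ℂ) :
    MellinConvergent (fun t : ℝ ↦ Real.log t • f t) s ∧
      HasDerivAt (mellin f) (mellin (fun t : ℝ ↦ Real.log t • f t) s) s :=
  mellin_hasDerivAt_of_isBigO_rpow (a := s.re + 1) (b := s.re - 1) hfc
    ((htop _).congr_right fun _ ↦ rfl) (by linarith) ((hbot _).congr_right fun _ ↦ rfl) (by linarith)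

open MellinIteratedDeriv in
/-- **`𝓜f` is entire** under two-sided all-order decay. [cite: Titchmarsh1986, §2.6] -/
theorem differentiable_mellin_of_isBigO_rpow {f : ℝ → ℂ} (hfc : LocallyIntegrableOn f (Ioi 0))
    (htop : ∀ r : ℝ, f =O[atTop] (· ^ r)) (hbot : ∀ r : ℝ, f =O[𝓝[>] 0] (· ^ r)) :
    Differentiable ℂ (mellin f) :=
  fun s ↦ (hasDerivAt_mellin_of_isBigO_rpow hfc htop hbot s).2.differentiableAt

open MellinIteratedDeriv in
/-- **Iterated differentiation under the Mellin integral**: under two-sided all-order decay,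
`(𝓜f)^{(n)}(s) = 𝓜(logⁿ·f)(s)` for every `n` and every `s` (and the right side converges absolutely).
[cite: Titchmarsh1986, §2.6; Keiper1992, eqs. (3), (7) p.765–766] -/
theorem iteratedDeriv_mellin_eq_of_isBigO_rpow {f : ℝ → ℂ} (hfc : LocallyIntegrableOn f (Ioi 0))
    (htop : ∀ r : ℝ, f =O[atTop] (· ^ r)) (hbot : ∀ r : ℝ, f =O[𝓝[>] 0] (· ^ r)) (n : ℕ) (s : ℂ) :
    iteratedDeriv n (mellin f) s = mellin (fun t : ℝ ↦ ((Real.log t) ^ n : ℝ) • f t) s := by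
  induction n generalizing s with
  | zero => simp
  | succ n ih =>
    rw [iteratedDeriv_succ, show iteratedDeriv n (mellin f) =
      mellin (fun t : ℝ ↦ ((Real.log t) ^ n : ℝ) • f t) from funext ih]
    have h := (hasDerivAt_mellin_of_isBigO_rpow (locallyIntegrableOn_log_pow_smul hfc n)
      (isBigO_log_pow_smul_atTop htop n) (isBigO_log_pow_smul_nhds_zero hbot n) s).2
    rw [h.deriv]
    congr 1
    funext t
    simp only [smul_smul, pow_succ, mul_comm]

open MellinIteratedDeriv in
/-- The right side of `iteratedDeriv_mellin_eq_of_isBigO_rpow` converges absolutely for every `n`, `s`.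
[cite: Titchmarsh1986, §2.6] -/
theorem mellinConvergent_log_pow_smul_of_isBigO_rpow {f : ℝ → ℂ}
    (hfc : LocallyIntegrableOn f (Ioi 0)) (htop : ∀ r : ℝ, f =O[atTop] (· ^ r))
    (hbot : ∀ r : ℝ, f =O[𝓝[>] 0] (· ^ r)) (n : ℕ) (s : ℂ) :
    MellinConvergent (fun t : ℝ ↦ ((Real.log t) ^ n : ℝ) • f t) s :=
  mellinConvergent_of_isBigO_rpow (a := s.re + 1) (b := s.re - 1)
    (locallyIntegrableOn_log_pow_smul hfc n)
    ((isBigO_log_pow_smul_atTop htop n _).congr_right fun _ ↦ rfl) (by linarith)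
    ((isBigO_log_pow_smul_nhds_zero hbot n _).congr_right fun _ ↦ rfl) (by linarith)

/-! ## Half-plane version: all-order decay at `+∞`, `O(x^{-b})` for every `b > b₀` at `0⁺`
(appended, cell landau-siegel / ls-inputs, line H-AFE2: the kernels `x e^{-x}`, `(x/c) e^{-x/c}` of Euler's
integral are `O(x)` at `0⁺`, so the strip of absolute convergence is the half-plane `Re s > -1` and the
iterated statement holds there: `(𝓜f)^{(n)}(s) = 𝓜(logⁿ·f)(s)` for `Re s > b₀`; [Titchmarsh1986, §2.6]). -/

namespace MellinIteratedDeriv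

variable {f : ℝ → ℂ}

/-- One-sided decay at `0⁺` (`O(x^{-b})` for every `b > b₀`) passes to `log t • f t`.
[cite: Titchmarsh1986, §2.6] -/
theorem isBigO_log_smul_nhds_zero_of_lt {b₀ : ℝ} (hbot : ∀ b : ℝ, b₀ < b → f =O[𝓝[>] 0] (· ^ (-b)))
    (b : ℝ) (hb : b₀ < b) :
    (fun t : ℝ ↦ Real.log t • f t) =O[𝓝[>] 0] (· ^ (-b)) :=
  isBigO_rpow_zero_log_smul (E := ℂ) (a := (b₀ + b) / 2) (b := b) (by linarith)
    (hbot _ (by linarith))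

/-- One-sided decay at `0⁺` passes to `logⁿ t • f t`. [cite: Titchmarsh1986, §2.6] -/
theorem isBigO_log_pow_smul_nhds_zero_of_lt {b₀ : ℝ}
    (hbot : ∀ b : ℝ, b₀ < b → f =O[𝓝[>] 0] (· ^ (-b))) (n : ℕ) (b : ℝ) (hb : b₀ < b) :
    (fun t : ℝ ↦ ((Real.log t) ^ n : ℝ) • f t) =O[𝓝[>] 0] (· ^ (-b)) := by
  induction n generalizing b with
  | zero => simpa using hbot b hb
  | succ n ih =>
    have h := isBigO_log_smul_nhds_zero_of_lt (f := fun t : ℝ ↦ ((Real.log t) ^ n : ℝ) • f t)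
      (b₀ := b₀) (fun b' hb' ↦ ih b' hb') b hb
    refine h.congr_left fun t ↦ ?_
    simp only [smul_smul, pow_succ, mul_comm]

end MellinIteratedDeriv

open MellinIteratedDeriv in
/-- **One step on a half-plane**: if `f` is locally integrable on `(0,∞)`, decays to every order at `+∞`
and is `O(x^{-b})` at `0⁺` for every `b > b₀`, then `𝓜f` has derivative `𝓜(log·f)` at every `s` with
`Re s > b₀` (Mathlib `mellin_hasDerivAt_of_isBigO_rpow` with the strip `(b₀+Re s)/2 < Re s < Re s + 1`).
[cite: Titchmarsh1986, §2.6] -/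
theorem hasDerivAt_mellin_of_isBigO_rpow_of_lt {f : ℝ → ℂ} {b₀ : ℝ}
    (hfc : LocallyIntegrableOn f (Ioi 0)) (htop : ∀ r : ℝ, f =O[atTop] (· ^ r))
    (hbot : ∀ b : ℝ, b₀ < b → f =O[𝓝[>] 0] (· ^ (-b))) {s : ℂ} (hs : b₀ < s.re) :
    MellinConvergent (fun t : ℝ ↦ Real.log t • f t) s ∧
      HasDerivAt (mellin f) (mellin (fun t : ℝ ↦ Real.log t • f t) s) s :=
  mellin_hasDerivAt_of_isBigO_rpow (a := s.re + 1) (b := (b₀ + s.re) / 2) hfc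
    ((htop _).congr_right fun _ ↦ rfl) (by linarith) (hbot _ (by linarith)) (by linarith)

open MellinIteratedDeriv in
/-- Absolute convergence of `𝓜(logⁿ·f)(s)` on the half-plane `Re s > b₀`. [cite: Titchmarsh1986, §2.6] -/
theorem mellinConvergent_log_pow_smul_of_isBigO_rpow_of_lt {f : ℝ → ℂ} {b₀ : ℝ}
    (hfc : LocallyIntegrableOn f (Ioi 0)) (htop : ∀ r : ℝ, f =O[atTop] (· ^ r))
    (hbot : ∀ b : ℝ, b₀ < b → f =O[𝓝[>] 0] (· ^ (-b))) (n : ℕ) {s : ℂ} (hs : b₀ < s.re) :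
    MellinConvergent (fun t : ℝ ↦ ((Real.log t) ^ n : ℝ) • f t) s :=
  mellinConvergent_of_isBigO_rpow (a := s.re + 1) (b := (b₀ + s.re) / 2)
    (locallyIntegrableOn_log_pow_smul hfc n)
    ((isBigO_log_pow_smul_atTop htop n _).congr_right fun _ ↦ rfl) (by linarith)
    (isBigO_log_pow_smul_nhds_zero_of_lt hbot n _ (by linarith)) (by linarith)

open MellinIteratedDeriv in
/-- `𝓜f` is holomorphic on the half-plane `Re s > b₀`. [cite: Titchmarsh1986, §2.6] -/
theorem differentiableOn_mellin_of_isBigO_rpow_of_lt {f : ℝ → ℂ} {b₀ : ℝ}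
    (hfc : LocallyIntegrableOn f (Ioi 0)) (htop : ∀ r : ℝ, f =O[atTop] (· ^ r))
    (hbot : ∀ b : ℝ, b₀ < b → f =O[𝓝[>] 0] (· ^ (-b))) :
    DifferentiableOn ℂ (mellin f) {s : ℂ | b₀ < s.re} := fun _ hs ↦
  (hasDerivAt_mellin_of_isBigO_rpow_of_lt hfc htop hbot hs).2.differentiableAt.differentiableWithinAt

open MellinIteratedDeriv in
/-- On the half-plane, `deriv 𝓜f` agrees with `𝓜(log·f)` near every point (the half-plane is open).
[cite: Titchmarsh1986, §2.6] -/
theorem deriv_mellin_eventuallyEq_of_isBigO_rpow_of_lt {f : ℝ → ℂ} {b₀ : ℝ}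
    (hfc : LocallyIntegrableOn f (Ioi 0)) (htop : ∀ r : ℝ, f =O[atTop] (· ^ r))
    (hbot : ∀ b : ℝ, b₀ < b → f =O[𝓝[>] 0] (· ^ (-b))) {s : ℂ} (hs : b₀ < s.re) :
    deriv (mellin f) =ᶠ[𝓝 s] mellin (fun t : ℝ ↦ Real.log t • f t) := by
  have hopen : IsOpen {z : ℂ | b₀ < z.re} := isOpen_lt continuous_const Complex.continuous_re
  filter_upwards [hopen.mem_nhds hs] with z hz
  exact (hasDerivAt_mellin_of_isBigO_rpow_of_lt hfc htop hbot hz).2.deriv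

open MellinIteratedDeriv in
/-- **Iterated differentiation under the Mellin integral on a half-plane**: if `f` is locally integrable
on `(0,∞)`, decays to every order at `+∞`, and is `O(x^{-b})` at `0⁺` for every `b > b₀`, then
`(𝓜f)^{(n)}(s) = 𝓜(logⁿ·f)(s)` for every `n` and every `s` with `Re s > b₀`.
[cite: Titchmarsh1986, §2.6] -/
theorem iteratedDeriv_mellin_eq_of_isBigO_rpow_of_lt {f : ℝ → ℂ} {b₀ : ℝ}
    (hfc : LocallyIntegrableOn f (Ioi 0)) (htop : ∀ r : ℝ, f =O[atTop] (· ^ r))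
    (hbot : ∀ b : ℝ, b₀ < b → f =O[𝓝[>] 0] (· ^ (-b))) (n : ℕ) {s : ℂ} (hs : b₀ < s.re) :
    iteratedDeriv n (mellin f) s = mellin (fun t : ℝ ↦ ((Real.log t) ^ n : ℝ) • f t) s := by
  induction n generalizing f with
  | zero => simp
  | succ n ih =>
    rw [iteratedDeriv_succ']
    have hev : deriv (mellin f) =ᶠ[𝓝 s] mellin (fun t : ℝ ↦ Real.log t • f t) :=
      deriv_mellin_eventuallyEq_of_isBigO_rpow_of_lt hfc htop hbot hs
    rw [hev.iteratedDeriv_eq n]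
    have hfc' : LocallyIntegrableOn (fun t : ℝ ↦ Real.log t • f t) (Ioi 0) := by
      simpa using locallyIntegrableOn_log_pow_smul hfc 1
    have htop' : ∀ r : ℝ, (fun t : ℝ ↦ Real.log t • f t) =O[atTop] (· ^ r) :=
      isBigO_log_smul_atTop htop
    have hbot' : ∀ b : ℝ, b₀ < b → (fun t : ℝ ↦ Real.log t • f t) =O[𝓝[>] 0] (· ^ (-b)) :=
      isBigO_log_smul_nhds_zero_of_lt hbot
    rw [ih hfc' htop' hbot']
    congr 1
    funext t
    simp only [smul_smul, pow_succ, mul_comm]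

end Literature.Analysis.SpecialFunctions
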